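import Literature.NumberTheory.EllipticCurves.Kato2004.EllipticUnitTatePairingValuesKOfGross
import Literature.NumberTheory.EllipticCurves.ZpExtensionArtinExponent
import Literature.NumberTheory.EllipticCurves.ZpExtensionRestrict
import Literature.NumberTheory.EllipticCurves.InertiaAboveEllCyclotomicProofs
import Literature.NumberTheory.EllipticCurves.CyclotomicZpExtension
import Literature.NumberTheory.EllipticCurves.PAdicBSD
import Literature.NumberTheory.EllipticCurves.Kato2004.TeichmullerBranchIndex
import Literature.NumberTheory.GaloisRepresentations.ModNCyclotomicCharacter
import Literature.NumberTheory.GaloisRepresentations.TateLevelOneWildOdd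
import Literature.NumberTheory.LFunctions.NormDirichletCharacter
import HarnessLib

/-!
# F1 → THE MATCH: Kato's value law (15.9.1) in Dirichlet-character currency (the (D-cyc) dictionary)

Summit `BirchSwinnertonDyer`, crux `SmallImageLowerHalfBothSigns` (stmt-23599), line `rtt_w3`, stub S4‴ (LEAD ruling «(V)→hV bridge = honda»).
Namespace `…Theorems.SmallImageRttF1Bridge`. THEOREMS ONLY. Kato's Prop. 15.9 / (15.9.1) (tree fact `Kato2004.CM.prop159_ellipticUnits_tatePairing_values_inert`,
Grössencharakter form `…_of_isGrossencharakter`) states the VALUE LAW (V) for continuous `χ : Γ_K →ₜ* ℂˣ` trivial on `Gal(K̄/K_n)`; THE MATCH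
(`SmallImageRttReciprocity.hval_core`, hypothesis `hV`) wants it for `p`-power-order DIRICHLET characters `χ mod p^{n+e₀}` with `χ(γ_cyc) = e(ζ)`,
factor `N𝔞 − e(B)·χ(N𝔞)⁻¹`, coefficients `ψ̄(𝔟)·χ(N𝔟)`. This file is the dictionary (layer-triviality of `σ ↦ χ(χ_{p^{n+e₀}}(σ))`, its value
`χ(γ_cyc)` at a cyclotomic variable, (D-cyc) `heckeIdealValue χ_Gal 𝔟 = χ(N𝔟)`), the rewritten fact ★★ `prop159_values_inert_dirichlet_of_isGrossencharakter`
((P) verbatim; one new premise `IsCyclotomicVariable p (res_{ℚ̄} γ_v)`), and the transport of that premise from the crux prefix's `γ` (§5).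
References: [Kato2004Asterisque] Prop. 15.9, (15.9.1); [Washington1997] §13.1, Prop. 13.2; [SerreAbelianLadic1968] I-1.2, I-2.1;
[NeukirchANT1999] VII §10 (10.6); [MazurTateTeitelbaum1986Invent] §I.13.
-/

-- the Theorems namespace of this sub repeats the summit name by design (D-0017 nested layout)
set_option linter.dupNamespace false

noncomputable section

open scoped Classical NumberField ComplexConjugate
open NumberField IsDedekindDomain Field Polynomial

namespace Summit.BirchSwinnertonDyer.BirchSwinnertonDyer.Theorems.SmallImageRttF1Bridge

open Literature.NumberTheory.EllipticCurves Literature.NumberTheory.EllipticCurves.AcSigned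
  Literature.NumberTheory.EllipticCurves.Kobayashi2003
  Literature.NumberTheory.GaloisRepresentations Literature.NumberTheory.GaloisRepresentations.DiscreteGaloisModule
  Literature.NumberTheory.GaloisCohomology Literature.NumberTheory.LFunctions
  Literature.NumberTheory.ComplexMultiplication.EllipticUnits
  Literature.NumberTheory.ComplexMultiplication.EllipticUnits.JohnsonLeungKings2011
  Literature.NumberTheory.EllipticCurves.Kato2004 Literature.NumberTheory.EllipticCurves.Kato2004.CM
  Literature.NumberTheory.EllipticCurves.Kato2004.LocalTate ZpExtension

/-! ## §1. Finite-group bookkeeping: `p`-power-order characters and torsion units -/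

section Bookkeeping

variable {p : ℕ} [Fact p.Prime]

/-- **A multiplicative character of `p`-power order kills every unit `t` with `t^{p−1} = 1`** (`χ(t)^{p−1} = 1 = χ(t)^{p^i}` and
`gcd(p − 1, p^i) = 1`). [cite: Washington1997, §7.2] -/
theorem apply_eq_one_of_orderOf_eq_prime_pow {N : ℕ} {R : Type*} [CommRing R] (χ : MulChar (ZMod N) R) (hord : ∃ i : ℕ, orderOf χ = p ^ i)
    {t : (ZMod N)ˣ} (ht : t ^ (p - 1) = 1) : χ (t : ZMod N) = 1 := by
  obtain ⟨i, hi⟩ := hord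
  have hp : p.Prime := Fact.out
  have h1 : χ (t : ZMod N) ^ (p - 1) = 1 := by rw [← map_pow, ← Units.val_pow_eq_pow_val, ht, Units.val_one, map_one]
  have h2 : χ (t : ZMod N) ^ p ^ i = 1 := by rw [← MulChar.pow_apply_coe, ← hi, pow_orderOf_eq_one, MulChar.one_apply_coe]
  have hcop : (p - 1).Coprime (p ^ i) := ((Nat.coprime_self_sub_left hp.one_le).mpr (Nat.coprime_one_left p)).pow_right i
  have h3 : χ (t : ZMod N) ^ (p - 1).gcd (p ^ i) = 1 := pow_gcd_eq_one.mpr ⟨h1, h2⟩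
  rwa [hcop.gcd_eq_one, pow_one] at h3

/-- **A torsion unit `ω ∈ ℤ_pˣ` (`p` odd) satisfies `ω^{p−1} = 1`** (`ker ℓ = μ(ℤ_p)` and `γ_cyc^{t·ℓ(u)} = u^t`, `t = p − 1`).
[cite: Washington1997, §5.1] [cite: Serre1973, Ch. II §3.2 Prop. 8] -/
theorem pow_sub_one_eq_one_of_isOfFinOrder (hp : p ≠ 2) {ω : ℤ_[p]ˣ} (hω : IsOfFinOrder ω) : ω ^ (p - 1) = 1 := by
  have h0 : CyclotomicZp.ell p ω = 0 := (CyclotomicZp.ell_eq_zero_iff p ω).mpr hω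
  have h := CyclotomicZp.cycPow_torsionOrder_mul_ell p ω
  rw [h0, mul_zero, AddChar.map_zero_eq_one, Kato2004.torsionOrder_of_ne_two p hp] at h
  exact Units.ext (by rw [Units.val_pow_eq_pow_val, ← h, Units.val_one])

/-- The reduction `ℤ_pˣ → (ℤ/p^k)ˣ` of a torsion unit has `(p−1)`-th power `1` (`p` odd). [cite: Washington1997, §5.1] -/
theorem unitsMap_toZModPow_pow_sub_one_of_isOfFinOrder (hp : p ≠ 2) (k : ℕ) {ω : ℤ_[p]ˣ} (hω : IsOfFinOrder ω) :
    Units.map (PadicInt.toZModPow k).toMonoidHom ω ^ (p - 1) = 1 := by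
  rw [← map_pow, pow_sub_one_eq_one_of_isOfFinOrder hp hω, map_one]

/-- In `(ℤ/p^{n+1})ˣ` every `pⁿ`-th power has `(p−1)`-th power `1` (`#(ℤ/p^{n+1})ˣ = (p−1)pⁿ`). [cite: Washington1997, §13.1] -/
theorem pow_prime_pow_pow_sub_one (n : ℕ) (w : (ZMod (p ^ (n + 1)))ˣ) : (w ^ p ^ n) ^ (p - 1) = 1 := by
  have hp : p.Prime := Fact.out
  haveI : NeZero (p ^ (n + 1)) := ⟨pow_ne_zero _ hp.ne_zero⟩
  have hcard : Fintype.card (ZMod (p ^ (n + 1)))ˣ = p ^ n * (p - 1) := by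
    rw [ZMod.card_units_eq_totient, Nat.totient_prime_pow hp (by omega), Nat.add_sub_cancel]
  rw [← pow_mul, ← hcard, pow_card_eq_one]

end Bookkeeping

/-! ## §2. The Galois character of a `p`-power-order Dirichlet character: layer-triviality and its value at the cyclotomic variable -/

section Galois

variable {K : Type} [Field K] [NumberField K] {p : ℕ} [Fact p.Prime]

omit [NumberField K] in
/-- ★ **`χ_p(σ) = ω · w^{pⁿ}` with `ω` torsion, for `σ ∈ Gal(K̄/K_n)`** and the CYCLOTOMIC `ℤ_p`-extension `κ` of `K`: writing
`κ(σ) = pⁿ·κ(τ)`, the element `σ·τ^{−pⁿ}` lies in `ker κ = χ_p⁻¹(μ(ℤ_p))`. [cite: Washington1997, §13.1] -/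
theorem exists_cyclotomicCharacter_eq_of_mem_layerSubgroup {κ : ZpExtension K p} (hκ : κ.IsCyclotomic) {n : ℕ}
    {σ : absoluteGaloisGroup K} (hσ : σ ∈ κ.layerSubgroup n) :
    ∃ ω w : ℤ_[p]ˣ, IsOfFinOrder ω ∧ GaloisRep.cyclotomicCharacter K p σ = ω * w ^ p ^ n := by
  rw [ZpExtension.mem_layerSubgroup] at hσ
  obtain ⟨b, hb⟩ := hσ
  obtain ⟨τ, hτ⟩ := κ.surjective (Multiplicative.ofAdd b)
  have hτ' : κ τ = Multiplicative.ofAdd b := hτ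
  have hσ' : κ σ = Multiplicative.ofAdd ((p : ℤ_[p]) ^ n * b) := by rw [← hb, ofAdd_toAdd]
  have hker : σ * (τ ^ p ^ n)⁻¹ ∈ κ.kerSubgroup := by
    rw [ZpExtension.mem_kerSubgroup, map_mul, map_inv, map_pow, hτ', hσ', ← ofAdd_nsmul, nsmul_eq_mul, Nat.cast_pow,
      ← ofAdd_neg, ← ofAdd_add, add_neg_cancel, ofAdd_zero]
  rw [hκ, Subgroup.mem_comap] at hker
  refine ⟨GaloisRep.cyclotomicCharacter K p (σ * (τ ^ p ^ n)⁻¹), GaloisRep.cyclotomicCharacter K p τ, (CommGroup.mem_torsion _).mp hker, ?_⟩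
  rw [← map_pow, ← map_mul, inv_mul_cancel_right]

/-- ★ **LAYER-TRIVIALITY**: for `p` odd, the cyclotomic `ℤ_p`-extension `κ` of `K`, and a Dirichlet character `χ mod p^{n+e₀}` of `p`-power
order, the Galois character `σ ↦ χ(χ_{p^{n+e₀}}(σ))` is trivial on `Gal(K̄/K_n)` — `χ_{p^{n+1}}(σ) = ω̄·w̄^{pⁿ}` has `(p−1)`-th power `1`.
[cite: Washington1997, §13.1 and Prop. 13.2] [cite: MazurTateTeitelbaum1986Invent, §I.13] -/
theorem dirichletGaloisCharacter_eq_one_of_mem_layerSubgroup (hp : p ≠ 2) {κ : ZpExtension K p} (hκ : κ.IsCyclotomic) {n : ℕ}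
    [NeZero ((p ^ (n + cyclotomicExponent p) : ℕ) : K)]
    (χ : DirichletCharacter ℂ (p ^ (n + cyclotomicExponent p))) (hord : ∃ i : ℕ, orderOf χ = p ^ i)
    {σ : absoluteGaloisGroup K} (hσ : σ ∈ κ.layerSubgroup n) : dirichletGaloisCharacter K χ σ = 1 := by
  obtain ⟨ω, w, hω, hχσ⟩ := exists_cyclotomicCharacter_eq_of_mem_layerSubgroup hκ hσ
  have ht : modNCyclotomicCharacter K (p ^ (n + cyclotomicExponent p)) σ ^ (p - 1) = 1 := by
    rw [modNCyclotomicCharacter_eq_unitsMap_cyclotomicCharacter, hχσ, map_mul, map_pow, mul_pow,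
      unitsMap_toZModPow_pow_sub_one_of_isOfFinOrder hp _ hω, one_mul]
    have h1 : cyclotomicExponent p = 1 := by unfold cyclotomicExponent; simp [hp]
    -- transport along `n + e₀ = n + 1`
    have key : ∀ (k : ℕ) (hk : k = n + 1) (u : (ZMod (p ^ k))ˣ), (u ^ p ^ n) ^ (p - 1) = 1 := by
      rintro k rfl u; exact pow_prime_pow_pow_sub_one n u
    exact key _ (by rw [h1]) _
  apply Units.ext
  rw [coe_dirichletGaloisCharacter_apply, Units.val_one, apply_eq_one_of_orderOf_eq_prime_pow χ hord ht]

/-- ★ **VALUE AT THE CYCLOTOMIC VARIABLE**: if the restriction of `γ ∈ Γ_K` to `ℚ̄` is a cyclotomic variable (`χ_p(γ)·ζ = γ_cyc`, `ζ`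
torsion), then `χ(χ_{p^{n+e₀}}(γ)) = χ(γ_cyc)` for every `χ mod p^{n+e₀}` of `p`-power order (`p` odd): `χ` kills `ζ̄`.
[cite: MazurTateTeitelbaum1986Invent, §I.13] [cite: Washington1997, §7.2] -/
theorem dirichletGaloisCharacter_apply_of_isCyclotomicVariable (hp : p ≠ 2) {n : ℕ} [NeZero ((p ^ (n + cyclotomicExponent p) : ℕ) : K)]
    (χ : DirichletCharacter ℂ (p ^ (n + cyclotomicExponent p))) (hord : ∃ i : ℕ, orderOf χ = p ^ i)
    {γ : absoluteGaloisGroup K} (hγ : IsCyclotomicVariable p (absGaloisRestrict ℚ K γ)) :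
    ((dirichletGaloisCharacter K χ γ : ℂˣ) : ℂ) = χ (cyclotomicGenerator p : ZMod (p ^ (n + cyclotomicExponent p))) := by
  obtain ⟨ζ, hζ, hprod⟩ := hγ
  have hres : GaloisRep.cyclotomicCharacter K p γ = GaloisRep.cyclotomicCharacter ℚ p (absGaloisRestrict ℚ K γ) :=
    cyclotomicCharacter_eq_cyclotomicCharacter_rat_absGaloisRestrict (K := K) p γ
  -- `χ_{p^k}(γ) · ζ̄ = γ_cyc mod p^k`, `k = n + e₀`
  have hU : (modNCyclotomicCharacter K (p ^ (n + cyclotomicExponent p)) γ : ZMod (p ^ (n + cyclotomicExponent p))) *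
        (Units.map (PadicInt.toZModPow (n + cyclotomicExponent p)).toMonoidHom ζ : ZMod (p ^ (n + cyclotomicExponent p))) =
      (cyclotomicGenerator p : ZMod (p ^ (n + cyclotomicExponent p))) := by
    rw [modNCyclotomicCharacter_eq_unitsMap_cyclotomicCharacter, hres, ← Units.val_mul, ← map_mul, Units.coe_map,
      RingHom.toMonoidHom_eq_coe, MonoidHom.coe_coe, hprod, map_natCast]
  have hζ1 : χ ((Units.map (PadicInt.toZModPow (n + cyclotomicExponent p)).toMonoidHom ζ : (ZMod (p ^ (n + cyclotomicExponent p)))ˣ) :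
      ZMod (p ^ (n + cyclotomicExponent p))) = 1 :=
    apply_eq_one_of_orderOf_eq_prime_pow χ hord (unitsMap_toZModPow_pow_sub_one_of_isOfFinOrder hp _ hζ)
  rw [coe_dirichletGaloisCharacter_apply, ← hU, map_mul, hζ1, mul_one]

end Galois

/-! ## §3. (D-cyc): `χ_Gal(Frob_v) = χ(N v)` and `heckeIdealValue χ_Gal 𝔟 = χ(N𝔟)` -/

section Dcyc

variable {K : Type} [Field K] [NumberField K] {N : ℕ} [NeZero N] [NeZero (N : K)]

omit [NumberField K] [NeZero N] [NeZero (N : K)] in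
/-- For a prime `𝔓` of `ℤ̄_K` above `v ∌ N`: `N ∉ 𝔓` (`𝔓 ∩ 𝒪_K = v`). [cite: NeukirchANT1999, Ch. I §9 (before (9.1))] -/
theorem natCast_not_mem_of_mem_primesAbove {v : HeightOneSpectrum (𝓞 K)} {𝔓 : Ideal (absIntegers (𝓞 K) K)}
    (h𝔓 : 𝔓 ∈ v.primesAbove) (hv : (N : 𝓞 K) ∉ v.asIdeal) : (N : absIntegers (𝓞 K) K) ∉ 𝔓 := by
  intro hmem
  have h1 : (N : 𝓞 K) ∈ 𝔓.under (𝓞 K) := by rw [Ideal.under_def, Ideal.mem_comap, map_natCast]; exact hmem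
  rw [← h𝔓.2.over] at h1
  exact hv h1

/-- The Galois character of a Dirichlet character `mod N` kills the inertia groups above every `v ∌ N` (`χ_N(I_𝔓) = 1`).
[cite: SerreAbelianLadic1968, Ch. I §1.2 and §2.1] -/
theorem dirichletGaloisCharacter_eq_one_of_mem_inertia (χ : DirichletCharacter ℂ N) {v : HeightOneSpectrum (𝓞 K)}
    (hv : (N : 𝓞 K) ∉ v.asIdeal) {𝔓 : Ideal (absIntegers (𝓞 K) K)} (h𝔓 : 𝔓 ∈ v.primesAbove) {σ : absoluteGaloisGroup K}
    (hσ : σ ∈ 𝔓.inertia (absoluteGaloisGroup K)) : dirichletGaloisCharacter K χ σ = 1 := by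
  haveI : 𝔓.IsPrime := h𝔓.1
  apply Units.ext
  rw [coe_dirichletGaloisCharacter_apply, modNCyclotomicCharacter_eq_one_of_mem_inertia (natCast_not_mem_of_mem_primesAbove h𝔓 hv) hσ,
    Units.val_one, Units.val_one, map_one]

/-- ★ **(D-cyc) at a prime: `χ_Gal(Frob_v) = χ(N v)`** for `v ∌ N` — the Galois character of `χ` is unramified at `v` and an arithmetic
Frobenius acts on `μ_N` by `ζ ↦ ζ^{N v}` (`modNCyclotomicCharacter_eq_residueCard_of_isArithFrobAt`); `heckeValueAt` reads the arithmetic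
Frobenius (Neukirch VII (10.6), proof). [cite: SerreAbelianLadic1968, Ch. I §1.2] [cite: NeukirchANT1999, Ch. VII §10 Thm. (10.6) (proof)] -/
theorem heckeValueAt_dirichletGaloisCharacter (χ : DirichletCharacter ℂ N) {v : HeightOneSpectrum (𝓞 K)} (hv : (N : 𝓞 K) ∉ v.asIdeal) :
    heckeValueAt (dirichletGaloisCharacter K χ) v = χ ((Ideal.absNorm v.asIdeal : ℕ) : ZMod N) := by
  have hur : GaloisRep.IsUnramifiedAt v (FramedArtinRep.toArtinRep (FramedRep.ofCharacter (dirichletGaloisCharacter K χ))) :=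
    (Gross2004.isUnramifiedAt_ofCharacter_iff _ v).mpr fun 𝔓 h𝔓 σ hσ ↦ dirichletGaloisCharacter_eq_one_of_mem_inertia χ hv h𝔓 hσ
  rw [Gross2004.heckeValueAt_eq_of_isUnramifiedAt _ hur (primeAbove_mem v) (isArithFrobAt_frobChoice v), coe_dirichletGaloisCharacter_apply,
    modNCyclotomicCharacter_eq_residueCard_of_isArithFrobAt (primeAbove_mem v) (natCast_not_mem_of_mem_primesAbove (primeAbove_mem v) hv)
      (isArithFrobAt_frobChoice v)]
  rfl

/-- ★ **(D-cyc) on ideals: `heckeIdealValue χ_Gal 𝔟 = χ(N𝔟)`** for `𝔟 ≠ 0` prime to `N` (multiplicativity of `N` and `χ`; the tree's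
`idealPow_normCharValue`). [cite: NeukirchANT1999, Ch. VII §10 Thm. (10.6) (proof) with Ch. I (3.3)] [cite: Washington1997, Prop. 13.2] -/
theorem heckeIdealValue_dirichletGaloisCharacter (χ : DirichletCharacter ℂ N) {I : Ideal (𝓞 K)} (hI : I ≠ ⊥)
    (hIN : IsCoprime I (Ideal.span {(N : 𝓞 K)})) :
    heckeIdealValue (dirichletGaloisCharacter K χ) I = χ ((Ideal.absNorm I : ℕ) : ZMod N) := by
  rw [← idealPow_normCharValue χ hI, heckeIdealValue, if_neg hI, idealPow]
  refine finprod_congr fun v ↦ ?_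
  rw [Ideal.count_associates_factors_eq hI v.isPrime v.ne_bot]
  by_cases hc : Multiset.count v.asIdeal (UniqueFactorizationMonoid.normalizedFactors I) = 0
  · rw [hc, pow_zero, pow_zero]
  · have hdvd : v.asIdeal ∣ I := UniqueFactorizationMonoid.dvd_of_mem_normalizedFactors (Multiset.count_ne_zero.mp hc)
    have hv : (N : 𝓞 K) ∉ v.asIdeal := fun hN ↦ by
      have hle : I ⊔ Ideal.span {(N : 𝓞 K)} ≤ v.asIdeal := sup_le (Ideal.le_of_dvd hdvd) ((Ideal.span_singleton_le_iff_mem _).mpr hN)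
      rw [Ideal.isCoprime_iff_sup_eq.mp hIN, top_le_iff] at hle
      exact v.isPrime.ne_top hle
    rw [heckeValueAt_dirichletGaloisCharacter χ hv, normCharValue_apply]

end Dcyc

/-! ## §4. Kato's value law in THE MATCH's currency -/

section Bridge

set_option maxHeartbeats 1600000 in
/-- ★★ **F1 in Dirichlet-character currency (the (D-cyc) half of the (V)→hV bridge).** The Grössencharakter form of Kato's Prop. 15.9 /
(15.9.1) (`CM.prop159_ellipticUnits_tatePairing_values_inert_of_isGrossencharakter`) with its value law (V) rewritten for THE MATCH
(`SmallImageRttReciprocity.hval_core`, hypothesis `hV`): for every `ζ ∈ ℚ̄_p`, every Dirichlet character `χ mod p^{n+e₀}` of `p`-power order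
with `χ(γ_cyc) = e ζ`, and every entire `Λ` agreeing on `re s > 3/2` with the depleted series `Σ_{(𝔟, p𝔣)=1} ψ̄(𝔟)·χ(N𝔟)·N𝔟^{−s}`:
`e(Σ_{m<pⁿ} ζ^m·Y_m) = Ω⁻¹ · (N𝔞 − ψ(𝔞)·χ(N𝔞)⁻¹) · Λ(1)`; the pairing law (P) is VERBATIM that of the fact. The value law is applied to the
Galois character `σ ↦ χ(χ_{p^{n+e₀}}(σ))`, trivial on `Gal(K̄/K_n)` (`dirichletGaloisCharacter_eq_one_of_mem_layerSubgroup`), whose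
ideal values are `χ(N𝔟)` (`heckeIdealValue_dirichletGaloisCharacter`) and whose value at `γ_v` is `χ(γ_cyc)`
(`dirichletGaloisCharacter_apply_of_isCyclotomicVariable`) — this last step is where the ONE new premise enters: the restriction of `γ_v` to
`ℚ̄` is a cyclotomic variable (`IsCyclotomicVariable`, the crux prefix's normalisation `χ_p(γ)·ζ = γ_cyc`).
[cite: Kato2004Asterisque, Prop. 15.9 and (15.9.1) (pp. 258–259)] [cite: Washington1997, §13.1 and Prop. 13.2]
[cite: MazurTateTeitelbaum1986Invent, §I.13] -/
theorem prop159_values_inert_dirichlet_of_isGrossencharakter (hF : prop159_ellipticUnits_tatePairing_values_inert) :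
  ∀ (K : Type) [Field K] [NumberField K] (σK : K →+* ℂ), Module.finrank ℚ K = 2 → IsTotallyComplex K →
  ∀ (p : ℕ) [Fact p.Prime], p ≠ 2 →
  ∀ (v : HeightOneSpectrum (𝓞 K)), v.asIdeal = Ideal.span {((p : ℕ) : 𝓞 K)} → ∀ (hpv : ((p : ℕ) : 𝓞 K) ∈ v.asIdeal),
  ∀ (κ : ZpExtension K p), κ.IsCyclotomic → ∀ (hvns : IsNonsplitIn κ v),
  ∀ (γv : absoluteGaloisGroup (v.adicCompletion K)), (localizeAt κ v hvns).IsTopGenerator γv →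
    -- NEW (THE MATCH's normalisation): `res_{ℚ̄} γ_v` is a cyclotomic variable, `χ_p(γ_v)·ζ = γ_cyc = 1 + p` with `ζ` torsion
    IsCyclotomicVariable p (absGaloisRestrict ℚ K (resGalOfEmb (closureEmb (K := K) (v.adicCompletion K)) γv)) →
  ∀ (𝔪 : Ideal (𝓞 K)) (h𝔪 : 𝔪 ≠ ⊥) (ψ : HeightOneSpectrum (𝓞 K) → ℂ) (hψ : IsGrossencharakter 𝔪 (embType σK) (embTypeConj σK) ψ),
  ∀ (𝔣 : Ideal (𝓞 K)), 𝔣 ≠ ⊥ → (∀ u : (𝓞 K)ˣ, (u : 𝓞 K) - 1 ∈ 𝔣 → u = 1) →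
    𝔪 ∣ 𝔣 →
  ∀ (S : Set (PadicAlgCl p)), FiniteDimensional ℚ_[p] (padicCoeffField S) →
  ∀ (θ : FramedGaloisRep K (padicCoeffIntegers S) 1) (θ' : absoluteGaloisGroup K →ₜ* (padicCoeffIntegers S)ˣ),
    (∀ g : absoluteGaloisGroup K, ((θ' g : (padicCoeffIntegers S)ˣ) : padicCoeffIntegers S) *
      ((θ g : GL (Fin 1) (padicCoeffIntegers S)) : Matrix (Fin 1) (Fin 1) (padicCoeffIntegers S)) 0 0 = 1) →
  ∀ (e : PadicAlgCl p ≃+* ℂ),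
    (∀ w : HeightOneSpectrum (𝓞 K), IsCoprime w.asIdeal (katoModulus p 𝔣 1) →
      θ.IsUnramifiedAt w ∧ ∃ P : Polynomial (padicCoeffIntegers S),
        P.map (padicCoeffIntegers S).subtype = Polynomial.X - Polynomial.C (e.symm (ψ w)) ∧ θ.HasFrobCharpolyAt w P) →
  ∀ (ιC : AlgebraicClosure K →+* ℂ), (∀ x : K, ιC (algebraMap K (AlgebraicClosure K) x) = σK x) →
  ∀ (Φ : AlgebraicClosure (v.adicCompletion K) →+* PadicAlgCl p),
    (letI := LocalField.adicCompletionPadicAlgebra v p hpv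
     ∀ y : ℚ_[p], Φ (algebraMap (v.adicCompletion K) (AlgebraicClosure (v.adicCompletion K)) (algebraMap ℚ_[p] (v.adicCompletion K) y)) =
       algebraMap ℚ_[p] (PadicAlgCl p) y) →
    (∀ x : AlgebraicClosure K, (∀ σ ∈ κ.kerSubgroup, σ • x = x) →
      e (Φ (closureEmb (K := K) (v.adicCompletion K) x)) = ιC x) →
  ∀ (W : WeierstrassCurve ℚ) [W.IsElliptic] [W.IsGloballyMinimal], W.HasGoodReductionAtPrime p → W.frobeniusTrace p = 0 →
  ∀ [DistribMulAction (absoluteGaloisGroup (v.adicCompletion K)) (GreenbergSelmer.Cofree θ (padicCoeffField S))]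
    (hres : ∀ (σ : absoluteGaloisGroup (v.adicCompletion K)) (m : GreenbergSelmer.Cofree θ (padicCoeffField S)),
      σ • m = resGalOfEmb (closureEmb (K := K) (v.adicCompletion K)) σ • m)
    (hstab : ∀ m : GreenbergSelmer.Cofree θ (padicCoeffField S),
      IsOpen (MulAction.stabilizer (absoluteGaloisGroup (v.adicCompletion K)) m : Set (absoluteGaloisGroup (v.adicCompletion K))))
    (j : (W.baseChange K).geomPrimaryTorsion p →+ GreenbergSelmer.Cofree θ (padicCoeffField S)),
    (∀ (δ : absoluteGaloisGroup (v.adicCompletion K)) (t : (W.baseChange K).geomPrimaryTorsion p),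
      j (resGalOfEmb (closureEmb (K := K) (v.adicCompletion K)) δ • t) = resGalOfEmb (closureEmb (K := K) (v.adicCompletion K)) δ • j t) →
    Submodule.span (padicCoeffIntegers S) (Set.range j) = ⊤ →
  ∃ (Ω : ℂ) (av : v.adicCompletion K) (aS : padicCoeffField S), Ω ≠ 0 ∧ av ≠ 0 ∧ aS ≠ 0 ∧
  ∀ (𝔞 : Ideal (𝓞 K)), IsCoprime 𝔞 (katoModulus6 p 𝔣) → ∀ (n : ℕ), ∃ Y : ℕ → PadicAlgCl p,
    -- (V′) THE VALUE LAW (15.9.1) IN THE MATCH's CURRENCY: Dirichlet characters `χ mod p^{n+e₀}` of `p`-power order with `χ(γ_cyc) = e ζ`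
    (∀ (ζ : PadicAlgCl p) (χ : DirichletCharacter ℂ (p ^ (n + cyclotomicExponent p))), (∃ i : ℕ, orderOf χ = p ^ i) →
      χ (cyclotomicGenerator p : ZMod (p ^ (n + cyclotomicExponent p))) = e ζ →
      ∀ Λ : ℂ → ℂ, Differentiable ℂ Λ →
        (∀ s : ℂ, 3 / 2 < s.re → Λ s =
          ∑' I : Ideal (𝓞 K), if IsCoprime I (katoModulus p 𝔣 1) then
            conj (Literature.NumberTheory.LFunctions.idealPow K ψ I) * χ ((Ideal.absNorm I : ℕ) : ZMod (p ^ (n + cyclotomicExponent p))) *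
              ((Ideal.absNorm I : ℕ) : ℂ) ^ (-s) else 0) →
        e (∑ m ∈ Finset.range (p ^ n), ζ ^ m * Y m) =
          Ω⁻¹ * (((Ideal.absNorm 𝔞 : ℕ) : ℂ) - Literature.NumberTheory.LFunctions.idealPow K ψ 𝔞 *
            (χ ((Ideal.absNorm 𝔞 : ℕ) : ZMod (p ^ (n + cyclotomicExponent p))))⁻¹) * Λ 1) ∧
    -- (P) THE PAIRING LAW at every torsion exponent `k` and every large Kato level `s` (VERBATIM the fact's)
    (∀ (k : ℕ), ∃ s₀ : ℕ, ∀ (s : ℕ), s₀ ≤ s → ∀ (hle : katoLevelSubgroup p 𝔣 s ≤ κ.layerSubgroup n)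
      (u β : (AlgebraicClosure K)ˣ) (c : levelCohO S (suppPF p 𝔣) θ' (katoLevelSubgroup p 𝔣 s) k 1),
      IsKatoUnitRepAt p ιC 𝔣 s 𝔞 u → β ^ (p ^ k) = u⁻¹ → IsTwistedKummerClassO S θ' (suppPF p 𝔣) (katoLevelSubgroup p 𝔣 s) k β c →
      ∀ [IsClosed ((localSubgroupOfEmb (κ.layerSubgroup n) (closureEmb (K := K) (v.adicCompletion K)) :
          Subgroup (absoluteGaloisGroup (v.adicCompletion K))) : Set (absoluteGaloisGroup (v.adicCompletion K)))]
        [Fintype (absoluteGaloisGroup (v.adicCompletion K) ⧸ localSubgroupOfEmb (κ.layerSubgroup n) (closureEmb (K := K) (v.adicCompletion K)))]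
        (lam : padicCoeffIntegers S →+ ℤ_[p]), (∀ (c : ℤ_[p]) (y : padicCoeffIntegers S), lam (padicIntToCoeffIntegers S c * y) = c * lam y) →
      ∀ (Pk : ContPairing (locCoeffRep S θ' (suppPF p 𝔣) v k).toTopRep (torsRep (GreenbergSelmer.Cofree θ (padicCoeffField S)) p hstab k).toTopRep
          (muAt K (p ^ k) v).toTopRep),
        (∀ (x : ↥(Representation.invariants ((muTwistO S θ' k).toRepresentation.comp (ramificationSubgroup K (suppPF p 𝔣)).subtype)))
            (a : padicCoeffIntegers S) (ζ : MuCarrier K (p ^ k)), (x : OMuCarrier K S (p ^ k)) = OMuCarrier.tmul a ζ →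
            ∀ t : Fin 1 → padicCoeffIntegers S,
              Pk.toLin x (divPowTors S K θ k t) = zmodSMulMu K (p ^ k) ζ (lamZMod S lam k (a * t 0))) →
      ∀ (Q' Q : localPoints (W.baseChange K) (v.adicCompletion K)),
        Q' ∈ localLayerPointsOfEmb κ (closureEmb (K := K) (v.adicCompletion K)) (W.baseChange K) n →
        Q' ∈ (W.baseChange K).localKernelOfReduction v → p ^ k • Q = Q' →
      ∀ (r : padicCoeffIntegers S)
        (φ : contOneCocycles (discreteTopRep (localSubgroupOfEmb (κ.layerSubgroup n) (closureEmb (K := K) (v.adicCompletion K)))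
          ↥(torsionPow (GreenbergSelmer.Cofree θ (padicCoeffField S)) p k))),
        (∀ (τ : localSubgroupOfEmb (κ.layerSubgroup n) (closureEmb (K := K) (v.adicCompletion K))) (t : (W.baseChange K).geomPrimaryTorsion p),
          pointsMapOfEmb (W.baseChange K) (closureEmb (K := K) (v.adicCompletion K)) (t : (W.baseChange K).geomPoints) =
              (τ : absoluteGaloisGroup (v.adicCompletion K)) • Q - Q →
            ((φ.1 τ : ↥(torsionPow (GreenbergSelmer.Cofree θ (padicCoeffField S)) p k)) : GreenbergSelmer.Cofree θ (padicCoeffField S)) = r • j t) →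
      ∃ t : padicCoeffIntegers S,
        (haveI : NeZero (p ^ k) := ⟨pow_ne_zero _ (Fact.out : p.Prime).ne_zero⟩
         localPairingSubgroup K (p ^ k) v (locCoeffRep S θ' (suppPF p 𝔣) v k) (torsRep (GreenbergSelmer.Cofree θ (padicCoeffField S)) p hstab k) Pk
            (localSubgroupOfEmb (κ.layerSubgroup n) (closureEmb (K := K) (v.adicCompletion K)))
            (locNK S κ θ' (suppPF p 𝔣) v n k
              (relCoresO S (suppPF p 𝔣) θ' hle (κ.isOpen_layerSubgroup n) (isOpen_absGaloisFixingSubgroup K (katoLayer p 𝔣 s)) k 1 c))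
            (oneCocycleClass _ φ) = PadicInt.toZModPow k (lam (r * t))) ∧
        (t : PadicAlgCl p) =
          Φ (algebraMap (v.adicCompletion K) (AlgebraicClosure (v.adicCompletion K)) av) * ((aS : padicCoeffField S) : PadicAlgCl p) *
            ∑ m ∈ Finset.range (p ^ n), Y m *
              (∑' i : ℕ, algebraMap ℚ_[p] (PadicAlgCl p) (PowerSeries.coeff i (W.map (algebraMap ℚ ℚ_[p])).formalLog) *
                Φ (WeierstrassCurve.Affine.Point.zCoord
                  (show ((W.baseChange K).baseChange (AlgebraicClosure (v.adicCompletion K))).toAffine.Point from (γv ^ m) • Q')) ^ i)) := by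
  intro K _ _ σK hK2 htc p _ hp v hv hpv κ hκ hvns γv hγv hγcyc 𝔪 h𝔪 ψ hψ 𝔣 h𝔣 hunits h𝔪𝔣 S hS θ θ' hθ'θ e hpin ιC hιC Φ hΦ hcoh
    W _ _ hgood hap _ hres hstab j hj hspan
  obtain ⟨Ω, av, aS, hΩ, hav, haS, hmain⟩ :=
    prop159_ellipticUnits_tatePairing_values_inert_of_isGrossencharakter hF K σK hK2 htc p hp v hv hpv κ hκ hvns γv hγv 𝔪 h𝔪 ψ hψ 𝔣 h𝔣
      hunits h𝔪𝔣 S hS θ θ' hθ'θ e hpin ιC hιC Φ hΦ hcoh W hgood hap hres hstab j hj hspan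
  refine ⟨Ω, av, aS, hΩ, hav, haS, fun 𝔞 h𝔞 n ↦ ?_⟩
  obtain ⟨Y, hV, hP⟩ := hmain 𝔞 h𝔞 n
  refine ⟨Y, fun ζ χ hord hχζ Λ hΛd hΛs ↦ ?_, hP⟩
  have hpr : p.Prime := Fact.out
  haveI : NeZero ((p ^ (n + cyclotomicExponent p) : ℕ) : K) := ⟨by exact_mod_cast pow_ne_zero _ hpr.ne_zero⟩
  have h𝔣𝔪 : 𝔣 ≤ 𝔪 := Ideal.le_of_dvd h𝔪𝔣
  -- ideals prime to `p𝔣` / `6p𝔣`: nonzero, prime to `𝔪`, prime to `p^{n+e₀}`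
  have hne : ∀ {I J : Ideal (𝓞 K)}, IsCoprime I J → J ≤ v.asIdeal → I ≠ ⊥ := by
    rintro I J hIJ hJ rfl
    have h := Ideal.isCoprime_iff_sup_eq.mp hIJ
    rw [bot_sup_eq] at h
    rw [h, top_le_iff] at hJ
    exact v.isPrime.ne_top hJ
  have hle_of : ∀ {I J J' : Ideal (𝓞 K)}, IsCoprime I J → J ≤ J' → IsCoprime I J' := by
    intro I J J' hIJ hJJ'
    refine Ideal.isCoprime_iff_sup_eq.mpr (top_le_iff.mp ?_)
    rw [← Ideal.isCoprime_iff_sup_eq.mp hIJ]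
    exact sup_le_sup_left hJJ' I
  have hpN : Ideal.span {((p : ℕ) : 𝓞 K)} ≤ v.asIdeal := (Ideal.span_singleton_le_iff_mem _).mpr hpv
  have hpow : ∀ {I : Ideal (𝓞 K)}, IsCoprime I (Ideal.span {((p : ℕ) : 𝓞 K)}) →
      IsCoprime I (Ideal.span {((p ^ (n + cyclotomicExponent p) : ℕ) : 𝓞 K)}) := by
    intro I hI
    rw [Nat.cast_pow, ← Ideal.span_singleton_pow]
    exact hI.pow_right
  have h𝔠p : katoModulus p 𝔣 1 ≤ Ideal.span {((p : ℕ) : 𝓞 K)} := by rw [katoModulus, pow_one]; exact Ideal.mul_le_right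
  have h𝔠𝔪 : katoModulus p 𝔣 1 ≤ 𝔪 := by rw [katoModulus]; exact Ideal.mul_le_left.trans h𝔣𝔪
  have h6p : katoModulus6 p 𝔣 ≤ Ideal.span {((p : ℕ) : 𝓞 K)} := by
    rw [katoModulus6]
    refine Ideal.mul_le_right.trans ((Ideal.span_singleton_le_iff_mem _).mpr ?_)
    rw [Nat.cast_mul]
    exact Ideal.mul_mem_left _ _ (Ideal.mem_span_singleton_self _)
  have h𝔞0 : 𝔞 ≠ ⊥ := hne h𝔞 (h6p.trans hpN)
  have h𝔞p : IsCoprime 𝔞 (Ideal.span {((p ^ (n + cyclotomicExponent p) : ℕ) : 𝓞 K)}) := hpow (hle_of h𝔞 h6p)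
  -- the Galois character of `χ`: trivial on `Gal(K̄/K_n)`
  have hχG : ∀ σ ∈ κ.layerSubgroup n, dirichletGaloisCharacter K χ σ = 1 := fun σ hσ ↦
    dirichletGaloisCharacter_eq_one_of_mem_layerSubgroup hp hκ χ hord hσ
  -- its depleted series is the Dirichlet-currency series
  have hL : IsDepletedHeckeLIdeal (heckeOfGross h𝔪 hψ) (dirichletGaloisCharacter K χ) (katoModulus p 𝔣 1) Λ := by
    refine ⟨hΛd, fun s hs ↦ ?_⟩
    rw [hΛs s hs, depletedHeckeLSeriesIdeal]
    refine tsum_congr fun I ↦ ?_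
    split_ifs with hI
    · rw [heckeCharIdealValue_heckeOfGross_eq_idealPow h𝔪 hψ (hne hI (h𝔠p.trans hpN)) (hle_of hI h𝔠𝔪),
        heckeIdealValue_dirichletGaloisCharacter χ (hne hI (h𝔠p.trans hpN)) (hpow (hle_of hI h𝔠p))]
    · rfl
  have hVal := hV (dirichletGaloisCharacter K χ) hχG Λ hL
  rw [dirichletGaloisCharacter_apply_of_isCyclotomicVariable hp χ hord hγcyc, hχζ,
    heckeIdealValue_dirichletGaloisCharacter χ h𝔞0 h𝔞p] at hVal
  rw [map_sum]
  simp_rw [map_mul, map_pow]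
  rw [hVal]
  ring

end Bridge

/-! ## §5. Transporting the crux prefix's normalisation `IsCyclotomicVariable p γ` to `γ_v` -/

section Transfer

variable {p : ℕ} [Fact p.Prime]

/-- ★ **The new premise of `prop159_values_inert_dirichlet_of_isGrossencharakter` from the crux prefix.** If `γ ∈ Γ_ℚ` is a topological
generator of the cyclotomic `κ` and a cyclotomic variable (`χ_p(γ)·ζ = γ_cyc`), then so is the restriction to `ℚ̄` of ANY topological generator
`γ′ ∈ Γ_K` of `κ|_K` (`[K : ℚ] = 2`, `p` odd): `γ⁻¹·res γ′ ∈ ker κ = χ_p⁻¹(μ(ℤ_p))`, so `χ_p(res γ′) = χ_p(γ)·ζ′` with `ζ′` torsion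
(the `κ`-form of `CyclotomicVariableKeyingProofs.isOfFinOrder_cyclotomicCharacter_inv_mul`). Apply with `γ′ = res_v γ_v` (prefix `hγv`).
[cite: MazurTateTeitelbaum1986Invent, §I.13] [cite: Washington1997, §13.1] -/
theorem isCyclotomicVariable_absGaloisRestrict_of_isTopGenerator (hp : p ≠ 2) {κ : ZpExtension ℚ p} (hκ : κ.IsCyclotomic)
    {K : Type} [Field K] [NumberField K] (hK2 : Module.finrank ℚ K = 2) {γ : absoluteGaloisGroup ℚ} (hγ : κ.IsTopGenerator γ)
    (hcv : IsCyclotomicVariable p γ) {γ' : absoluteGaloisGroup K} (hγ' : (κ.restrictOfFinrankEqTwo hp K hK2).IsTopGenerator γ') :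
    IsCyclotomicVariable p (absGaloisRestrict ℚ K γ') := by
  obtain ⟨ζ, hζ, hprod⟩ := hcv
  have h1 : κ (absGaloisRestrict ℚ K γ') = Multiplicative.ofAdd 1 := by rw [← ZpExtension.restrictOfFinrankEqTwo_apply hp κ K hK2]; exact hγ'
  have hker : γ⁻¹ * absGaloisRestrict ℚ K γ' ∈ κ.kerSubgroup := by
    rw [ZpExtension.mem_kerSubgroup, map_mul, map_inv, h1, show κ γ = Multiplicative.ofAdd 1 from hγ, inv_mul_cancel]
  rw [hκ, Subgroup.mem_comap] at hker
  have hfin : IsOfFinOrder (GaloisRep.cyclotomicCharacter ℚ p (γ⁻¹ * absGaloisRestrict ℚ K γ')) := (CommGroup.mem_torsion _).mp hker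
  refine ⟨(GaloisRep.cyclotomicCharacter ℚ p (γ⁻¹ * absGaloisRestrict ℚ K γ'))⁻¹ * ζ, hfin.inv.mul hζ, ?_⟩
  rw [← hprod, map_mul, map_inv]; congr 1; group

end Transfer

end Summit.BirchSwinnertonDyer.BirchSwinnertonDyer.Theorems.SmallImageRttF1Bridge

end
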